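import Mathlib
import HarnessLib
import Summits.AtomisticToContinuum.Crystallization.Theorems.PricedLinkCensusSoftFourRingsPosition

/-!
# Soft four-rings: two slack triangles are impossible (first part)

Support file for `SoftFourRings` (route `PricedLinkCensus`, sub-problem `Crystallization`).
Bond-set level: the data of a block (the conclusion of `slack_block`, without the bond-triangle
counts) is taken as one hypothesis per block.

* `two_blocks_aa` : two blocks with `r₁ = a₂`, `r₂ = a₁` are impossible (closure of the ten named
  vertices);
* `two_blocks_a` : two blocks with `r₁ = a₂` are impossible.
-/

namespace Summit.AtomisticToContinuum.Crystallization.Theorems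

open Real RealInnerProductSpace Literature.Geometry.DiscreteGeometry

section Setting

variable {X : Finset (EuclideanSpace ℝ (Fin 3))} {B : Finset (Finset (EuclideanSpace ℝ (Fin 3)))}
  (hB : ∀ T ∈ B, ∃ u ∈ X, ∃ u' ∈ X, u ≠ u' ∧ 1 - (101 / 100 : ℝ) ^ 2 / 2 ≤ ⟪u, u'⟫ ∧ T = {u, u'})
  (hcard : X.card = 12)
  (hdeg : ∀ v ∈ X, ∃ w : Fin 4 → EuclideanSpace ℝ (Fin 3), (∀ k, w k ∈ X) ∧
    Function.Injective w ∧ (∀ k, w k ≠ v) ∧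
    (∀ k, ({v, w k} : Finset (EuclideanSpace ℝ (Fin 3))) ∈ B) ∧
    ∀ y, ({v, y} : Finset (EuclideanSpace ℝ (Fin 3))) ∈ B → ∃ k, y = w k)

include hB hcard hdeg in
/-- Two blocks with `r₁ = a₂` and `r₂ = a₁` are impossible. -/
theorem two_blocks_aa {a1 b1 c1 p1 q1 u1 w1 m1 n1 r1 a2 b2 c2 p2 q2 u2 w2 m2 n2 r2 : EuclideanSpace ℝ (Fin 3)}
    (ha1 : a1 ∈ X) (hb1 : b1 ∈ X) (hc1 : c1 ∈ X) (ha2 : a2 ∈ X) (hb2 : b2 ∈ X) (hc2 : c2 ∈ X)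
    (h1 : ((p1 ∈ X ∧ q1 ∈ X ∧ u1 ∈ X ∧ w1 ∈ X ∧ m1 ∈ X ∧ n1 ∈ X ∧ r1 ∈ X) ∧
      (∀ y, ({a1, y} : Finset (EuclideanSpace ℝ (Fin 3))) ∈ B ↔ (y = p1 ∨ y = u1 ∨ y = r1 ∨ y = b1)) ∧
      (∀ y, ({b1, y} : Finset (EuclideanSpace ℝ (Fin 3))) ∈ B ↔ (y = q1 ∨ y = w1 ∨ y = r1 ∨ y = a1)) ∧
      (∀ y, ({c1, y} : Finset (EuclideanSpace ℝ (Fin 3))) ∈ B ↔ (y = p1 ∨ y = n1 ∨ y = m1 ∨ y = q1)) ∧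
      (∀ y, ({r1, y} : Finset (EuclideanSpace ℝ (Fin 3))) ∈ B ↔ (y = u1 ∨ y = a1 ∨ y = b1 ∨ y = w1)) ∧
      (({p1, u1} : Finset (EuclideanSpace ℝ (Fin 3))) ∈ B ∧
        ({u1, r1} : Finset (EuclideanSpace ℝ (Fin 3))) ∈ B ∧
        ({r1, b1} : Finset (EuclideanSpace ℝ (Fin 3))) ∈ B ∧
        ({q1, w1} : Finset (EuclideanSpace ℝ (Fin 3))) ∈ B ∧
        ({w1, r1} : Finset (EuclideanSpace ℝ (Fin 3))) ∈ B ∧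
        ({p1, n1} : Finset (EuclideanSpace ℝ (Fin 3))) ∈ B ∧
        ({n1, m1} : Finset (EuclideanSpace ℝ (Fin 3))) ∈ B ∧
        ({m1, q1} : Finset (EuclideanSpace ℝ (Fin 3))) ∈ B) ∧
      (({p1, r1} : Finset (EuclideanSpace ℝ (Fin 3))) ∉ B ∧
        ({u1, b1} : Finset (EuclideanSpace ℝ (Fin 3))) ∉ B ∧
        ({p1, b1} : Finset (EuclideanSpace ℝ (Fin 3))) ∉ B ∧
        ({q1, r1} : Finset (EuclideanSpace ℝ (Fin 3))) ∉ B ∧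
        ({w1, a1} : Finset (EuclideanSpace ℝ (Fin 3))) ∉ B ∧
        ({q1, a1} : Finset (EuclideanSpace ℝ (Fin 3))) ∉ B ∧
        ({p1, m1} : Finset (EuclideanSpace ℝ (Fin 3))) ∉ B ∧
        ({n1, q1} : Finset (EuclideanSpace ℝ (Fin 3))) ∉ B ∧
        ({p1, q1} : Finset (EuclideanSpace ℝ (Fin 3))) ∉ B ∧
        ({u1, w1} : Finset (EuclideanSpace ℝ (Fin 3))) ∉ B) ∧
      ((p1 ≠ u1 ∧ p1 ≠ r1 ∧ p1 ≠ b1 ∧ u1 ≠ r1 ∧ u1 ≠ b1 ∧ r1 ≠ b1) ∧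
        (q1 ≠ w1 ∧ q1 ≠ r1 ∧ q1 ≠ a1 ∧ w1 ≠ r1 ∧ w1 ≠ a1 ∧ r1 ≠ a1) ∧
        (p1 ≠ n1 ∧ p1 ≠ m1 ∧ p1 ≠ q1 ∧ n1 ≠ m1 ∧ n1 ≠ q1 ∧ m1 ≠ q1) ∧
        (u1 ≠ a1 ∧ u1 ≠ b1 ∧ u1 ≠ w1 ∧ a1 ≠ b1 ∧ a1 ≠ w1 ∧ b1 ≠ w1) ∧ r1 ≠ c1) ∧
      (∀ y, ({p1, y} : Finset (EuclideanSpace ℝ (Fin 3))) ∈ B ↔ (y = a1 ∨ y = u1 ∨ y = c1 ∨ y = n1)) ∧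
      (∀ y, ({q1, y} : Finset (EuclideanSpace ℝ (Fin 3))) ∈ B ↔ (y = b1 ∨ y = w1 ∨ y = c1 ∨ y = m1))))
    (h2 : ((p2 ∈ X ∧ q2 ∈ X ∧ u2 ∈ X ∧ w2 ∈ X ∧ m2 ∈ X ∧ n2 ∈ X ∧ r2 ∈ X) ∧
      (∀ y, ({a2, y} : Finset (EuclideanSpace ℝ (Fin 3))) ∈ B ↔ (y = p2 ∨ y = u2 ∨ y = r2 ∨ y = b2)) ∧
      (∀ y, ({b2, y} : Finset (EuclideanSpace ℝ (Fin 3))) ∈ B ↔ (y = q2 ∨ y = w2 ∨ y = r2 ∨ y = a2)) ∧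
      (∀ y, ({c2, y} : Finset (EuclideanSpace ℝ (Fin 3))) ∈ B ↔ (y = p2 ∨ y = n2 ∨ y = m2 ∨ y = q2)) ∧
      (∀ y, ({r2, y} : Finset (EuclideanSpace ℝ (Fin 3))) ∈ B ↔ (y = u2 ∨ y = a2 ∨ y = b2 ∨ y = w2)) ∧
      (({p2, u2} : Finset (EuclideanSpace ℝ (Fin 3))) ∈ B ∧
        ({u2, r2} : Finset (EuclideanSpace ℝ (Fin 3))) ∈ B ∧
        ({r2, b2} : Finset (EuclideanSpace ℝ (Fin 3))) ∈ B ∧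
        ({q2, w2} : Finset (EuclideanSpace ℝ (Fin 3))) ∈ B ∧
        ({w2, r2} : Finset (EuclideanSpace ℝ (Fin 3))) ∈ B ∧
        ({p2, n2} : Finset (EuclideanSpace ℝ (Fin 3))) ∈ B ∧
        ({n2, m2} : Finset (EuclideanSpace ℝ (Fin 3))) ∈ B ∧
        ({m2, q2} : Finset (EuclideanSpace ℝ (Fin 3))) ∈ B) ∧
      (({p2, r2} : Finset (EuclideanSpace ℝ (Fin 3))) ∉ B ∧
        ({u2, b2} : Finset (EuclideanSpace ℝ (Fin 3))) ∉ B ∧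
        ({p2, b2} : Finset (EuclideanSpace ℝ (Fin 3))) ∉ B ∧
        ({q2, r2} : Finset (EuclideanSpace ℝ (Fin 3))) ∉ B ∧
        ({w2, a2} : Finset (EuclideanSpace ℝ (Fin 3))) ∉ B ∧
        ({q2, a2} : Finset (EuclideanSpace ℝ (Fin 3))) ∉ B ∧
        ({p2, m2} : Finset (EuclideanSpace ℝ (Fin 3))) ∉ B ∧
        ({n2, q2} : Finset (EuclideanSpace ℝ (Fin 3))) ∉ B ∧
        ({p2, q2} : Finset (EuclideanSpace ℝ (Fin 3))) ∉ B ∧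
        ({u2, w2} : Finset (EuclideanSpace ℝ (Fin 3))) ∉ B) ∧
      ((p2 ≠ u2 ∧ p2 ≠ r2 ∧ p2 ≠ b2 ∧ u2 ≠ r2 ∧ u2 ≠ b2 ∧ r2 ≠ b2) ∧
        (q2 ≠ w2 ∧ q2 ≠ r2 ∧ q2 ≠ a2 ∧ w2 ≠ r2 ∧ w2 ≠ a2 ∧ r2 ≠ a2) ∧
        (p2 ≠ n2 ∧ p2 ≠ m2 ∧ p2 ≠ q2 ∧ n2 ≠ m2 ∧ n2 ≠ q2 ∧ m2 ≠ q2) ∧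
        (u2 ≠ a2 ∧ u2 ≠ b2 ∧ u2 ≠ w2 ∧ a2 ≠ b2 ∧ a2 ≠ w2 ∧ b2 ≠ w2) ∧ r2 ≠ c2) ∧
      (∀ y, ({p2, y} : Finset (EuclideanSpace ℝ (Fin 3))) ∈ B ↔ (y = a2 ∨ y = u2 ∨ y = c2 ∨ y = n2)) ∧
      (∀ y, ({q2, y} : Finset (EuclideanSpace ℝ (Fin 3))) ∈ B ↔ (y = b2 ∨ y = w2 ∨ y = c2 ∨ y = m2))))
    {V3 : EuclideanSpace ℝ (Fin 3) → Prop} (hVa1 : V3 a1) (hVc1 : V3 c1) (hVa2 : V3 a2)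
    (hVb2 : V3 b2) (hVc2 : V3 c2) (hVp1 : ¬ V3 p1) (hVq1 : ¬ V3 q1) (hVq2 : ¬ V3 q2)
    (hdisj : ∀ y, (y = a1 ∨ y = b1 ∨ y = c1) → ¬ (y = a2 ∨ y = b2 ∨ y = c2))
    (hac1 : a1 ≠ c1) (hbc1 : b1 ≠ c1) (hac2 : a2 ≠ c2) (hbc2 : b2 ≠ c2)
    (hr1 : r1 = a2) (hr2 : r2 = a1) : False := by
  classical
  obtain ⟨⟨hp1X, hq1X, hu1X, hw1X, hm1X, hn1X, hr1X⟩, hNa1, hNb1, hNc1, hNr1,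
    ⟨hBpu1, hBur1, hBrb1, hBqw1, hBwr1, hBpn1, hBnm1, hBmq1⟩,
    ⟨hBpr1, hBub1, hBpb1, hBqr1, hBwa1, hBqa1, hBpm1, hBnq1, hBpq1, hBuw1⟩,
    ⟨⟨hpu1, hpr1, hpb1, hur1, hub1, hrb1⟩, ⟨hqw1, hqr1, hqa1, hwr1, hwa1, hra1⟩,
      ⟨hpn1, hpm1, hpq1, hnm1, hnq1, hmq1⟩, ⟨hua1, hub'1, huw1, hab1, haw1, hbw1⟩, hrc1⟩,
    hNp1, hNq1⟩ := h1
  obtain ⟨⟨hp2X, hq2X, hu2X, hw2X, hm2X, hn2X, hr2X⟩, hNa2, hNb2, hNc2, hNr2,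
    ⟨hBpu2, hBur2, hBrb2, hBqw2, hBwr2, hBpn2, hBnm2, hBmq2⟩,
    ⟨hBpr2, hBub2, hBpb2, hBqr2, hBwa2, hBqa2, hBpm2, hBnq2, hBpq2, hBuw2⟩,
    ⟨⟨hpu2, hpr2, hpb2, hur2, hub2, hrb2⟩, ⟨hqw2, hqr2, hqa2, hwr2, hwa2, hra2⟩,
      ⟨hpn2, hpm2, hpq2, hnm2, hnq2, hmq2⟩, ⟨hua2, hub'2, huw2, hab2, haw2, hbw2⟩, hrc2⟩,
    hNp2, hNq2⟩ := h2
  subst r1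
  subst r2
  -- position at `r₁ = a₂`
  rcases fan_paths_eq hB hNa2 hNr1 hBpu2 hBur2 hBrb2 hBpr2 hBub2 hBpb2
      (by rw [Finset.pair_comm]; exact (hNa1 u1).2 (Or.inr (Or.inl rfl)))
      ((hNa1 b1).2 (Or.inr (Or.inr (Or.inr rfl)))) ((hNb1 w1).2 (Or.inr (Or.inl rfl))) hub1 haw1
      hab1 with ⟨-, -, e, -⟩ | ⟨hu1, -, hu2, hw1⟩
  · exact hab1 e.symm
  -- position at `r₂ = a₁`
  rcases fan_paths_eq hB hNa1 hNr2 hBpu1 hBur1 hBrb1 hBpr1 hBub1 hBpb1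
      (by rw [Finset.pair_comm]; exact (hNa2 u2).2 (Or.inr (Or.inl rfl)))
      ((hNa2 b2).2 (Or.inr (Or.inr (Or.inr rfl)))) ((hNb2 w2).2 (Or.inr (Or.inl rfl))) hub2 haw2
      hab2 with ⟨-, -, e, -⟩ | ⟨-, -, -, hw2⟩
  · exact hab2 e.symm
  subst u1
  subst w1
  subst w2
  replace hu2 := hu2.symm
  subst u2
  -- `q₁ = m'₂`, `q₂ = m'₁`, `c₂ = m₁`, `c₁ = m₂`
  have hq1 : q1 = n2 := by
    rcases (hNp2 q1).1 (by rw [Finset.pair_comm]; exact hBqw1) with e | e | e | e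
    · exact absurd (e ▸ hVa2) hVq1
    · exact absurd e (ne_of_mem_bonds hB ((hNb1 q1).2 (Or.inl rfl))).symm
    · exact absurd (e ▸ hVc2) hVq1
    · exact e
  have hq2 : q2 = n1 := by
    rcases (hNp1 q2).1 (by rw [Finset.pair_comm]; exact hBqw2) with e | e | e | e
    · exact absurd (e ▸ hVa1) hVq2
    · exact absurd e (ne_of_mem_bonds hB ((hNb2 q2).2 (Or.inl rfl))).symm
    · exact absurd (e ▸ hVc1) hVq2
    · exact e
  subst n2
  subst n1
  have hm1 : c2 = m1 := by
    rcases (hNq1 c2).1 (by rw [Finset.pair_comm]; exact (hNc2 q1).2 (Or.inr (Or.inl rfl))) with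
      e | e | e | e
    · exact absurd e.symm (hdisj b1 (Or.inr (Or.inl rfl)) ∘ Or.inr ∘ Or.inr)
    · exact absurd e.symm (ne_of_mem_bonds hB ((hNp2 c2).2 (Or.inr (Or.inr (Or.inl rfl)))))
    · exact absurd e.symm (hdisj c1 (Or.inr (Or.inr rfl)) ∘ Or.inr ∘ Or.inr)
    · exact e
  have hm2 : c1 = m2 := by
    rcases (hNq2 c1).1 (by rw [Finset.pair_comm]; exact (hNc1 q2).2 (Or.inr (Or.inl rfl))) with
      e | e | e | e
    · exact absurd e (hdisj c1 (Or.inr (Or.inr rfl)) ∘ Or.inr ∘ Or.inl)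
    · exact absurd e.symm (ne_of_mem_bonds hB ((hNp1 c1).2 (Or.inr (Or.inr (Or.inl rfl)))))
    · exact absurd e (hdisj c1 (Or.inr (Or.inr rfl)) ∘ Or.inr ∘ Or.inr)
    · exact e
  subst m1
  subst m2
  -- closure of the ten named vertices
  set W : Finset (EuclideanSpace ℝ (Fin 3)) := {a1, b1, c1, p1, q1, a2, b2, c2, p2, q2} with hW
  have hWX : W ⊆ X := by
    intro x hx
    simp only [W, Finset.mem_insert, Finset.mem_singleton] at hx
    rcases hx with rfl | rfl | rfl | rfl | rfl | rfl | rfl | rfl | rfl | rfl <;> assumption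
  have h10 : W.card ≤ 10 := by
    have := List.toFinset_card_le [a1, b1, c1, p1, q1, a2, b2, c2, p2, q2]
    simpa [W] using this
  have hp1a1 : p1 ≠ a1 := (ne_of_mem_bonds hB ((hNa1 p1).2 (Or.inl rfl))).symm
  have hp1c1 : p1 ≠ c1 := (ne_of_mem_bonds hB ((hNc1 p1).2 (Or.inl rfl))).symm
  have hq1b1 : q1 ≠ b1 := (ne_of_mem_bonds hB ((hNb1 q1).2 (Or.inl rfl))).symm
  have hq1c1 : q1 ≠ c1 := (ne_of_mem_bonds hB ((hNc1 q1).2 (Or.inr (Or.inr (Or.inr rfl))))).symm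
  have hq1a1 : q1 ≠ a1 := fun h => hVq1 (h ▸ hVa1)
  have hp1a2 : p1 ≠ a2 := fun h => hVp1 (h ▸ hVa2)
  have hp1b2 : p1 ≠ b2 := fun h => hVp1 (h ▸ hVb2)
  have hp1c2 : p1 ≠ c2 := fun h => hVp1 (h ▸ hVc2)
  have hq1a2 : q1 ≠ a2 := fun h => hVq1 (h ▸ hVa2)
  have hq1b2 : q1 ≠ b2 := fun h => hVq1 (h ▸ hVb2)
  have hq1c2 : q1 ≠ c2 := fun h => hVq1 (h ▸ hVc2)
  have h1a := hdisj a1 (Or.inl rfl)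
  have h1b := hdisj b1 (Or.inr (Or.inl rfl))
  have h1c := hdisj c1 (Or.inr (Or.inr rfl))
  have h8 : 8 ≤ W.card := by
    have hS : ({p1, q1, a1, b1, c1, a2, b2, c2} : Finset (EuclideanSpace ℝ (Fin 3))) ⊆ W := by
      intro x hx
      simp only [Finset.mem_insert, Finset.mem_singleton] at hx
      simp only [W, Finset.mem_insert, Finset.mem_singleton]
      rcases hx with rfl | rfl | rfl | rfl | rfl | rfl | rfl | rfl <;> simp
    have hS8 : ({p1, q1, a1, b1, c1, a2, b2, c2} : Finset (EuclideanSpace ℝ (Fin 3))).card = 8 := by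
      rw [Finset.card_insert_of_notMem, Finset.card_insert_of_notMem, Finset.card_insert_of_notMem,
        Finset.card_insert_of_notMem, Finset.card_insert_of_notMem, Finset.card_insert_of_notMem,
        Finset.card_pair hbc2]
      · simp only [Finset.mem_insert, Finset.mem_singleton, not_or]; exact ⟨hab2, hac2⟩
      · simp only [Finset.mem_insert, Finset.mem_singleton, not_or]
        exact ⟨fun h => h1c (Or.inl h), fun h => h1c (Or.inr (Or.inl h)), fun h => h1c (Or.inr (Or.inr h))⟩
      · simp only [Finset.mem_insert, Finset.mem_singleton, not_or]
        exact ⟨hbc1, fun h => h1b (Or.inl h), fun h => h1b (Or.inr (Or.inl h)),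
          fun h => h1b (Or.inr (Or.inr h))⟩
      · simp only [Finset.mem_insert, Finset.mem_singleton, not_or]
        exact ⟨hab1, hac1, fun h => h1a (Or.inl h), fun h => h1a (Or.inr (Or.inl h)),
          fun h => h1a (Or.inr (Or.inr h))⟩
      · simp only [Finset.mem_insert, Finset.mem_singleton, not_or]
        exact ⟨hq1a1, hq1b1, hq1c1, hq1a2, hq1b2, hq1c2⟩
      · simp only [Finset.mem_insert, Finset.mem_singleton, not_or]
        exact ⟨hpq1, hp1a1, hpb1, hp1c1, hp1a2, hp1b2, hp1c2⟩
    exact hS8 ▸ Finset.card_le_card hS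
  refine false_of_closed hcard hdeg W hWX h8 h10 ?_
  intro x hx z hz
  simp only [W, Finset.mem_insert, Finset.mem_singleton] at hx
  rcases hx with rfl | rfl | rfl | rfl | rfl | rfl | rfl | rfl | rfl | rfl
  · rcases (hNa1 z).1 hz with rfl | rfl | rfl | rfl <;> simp [W]
  · rcases (hNb1 z).1 hz with rfl | rfl | rfl | rfl <;> simp [W]
  · rcases (hNc1 z).1 hz with rfl | rfl | rfl | rfl <;> simp [W]
  · rcases (hNp1 z).1 hz with rfl | rfl | rfl | rfl <;> simp [W]
  · rcases (hNq1 z).1 hz with rfl | rfl | rfl | rfl <;> simp [W]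
  · rcases (hNa2 z).1 hz with rfl | rfl | rfl | rfl <;> simp [W]
  · rcases (hNb2 z).1 hz with rfl | rfl | rfl | rfl <;> simp [W]
  · rcases (hNc2 z).1 hz with rfl | rfl | rfl | rfl <;> simp [W]
  · rcases (hNp2 z).1 hz with rfl | rfl | rfl | rfl <;> simp [W]
  · rcases (hNq2 z).1 hz with rfl | rfl | rfl | rfl <;> simp [W]

include hB hcard hdeg in
/-- Two blocks with `r₁ = a₂` are impossible. -/
theorem two_blocks_a {a1 b1 c1 p1 q1 u1 w1 m1 n1 r1 a2 b2 c2 p2 q2 u2 w2 m2 n2 r2 : EuclideanSpace ℝ (Fin 3)}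
    (ha1 : a1 ∈ X) (hb1 : b1 ∈ X) (hc1 : c1 ∈ X) (ha2 : a2 ∈ X) (hb2 : b2 ∈ X) (hc2 : c2 ∈ X)
    (h1 : ((p1 ∈ X ∧ q1 ∈ X ∧ u1 ∈ X ∧ w1 ∈ X ∧ m1 ∈ X ∧ n1 ∈ X ∧ r1 ∈ X) ∧
      (∀ y, ({a1, y} : Finset (EuclideanSpace ℝ (Fin 3))) ∈ B ↔ (y = p1 ∨ y = u1 ∨ y = r1 ∨ y = b1)) ∧
      (∀ y, ({b1, y} : Finset (EuclideanSpace ℝ (Fin 3))) ∈ B ↔ (y = q1 ∨ y = w1 ∨ y = r1 ∨ y = a1)) ∧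
      (∀ y, ({c1, y} : Finset (EuclideanSpace ℝ (Fin 3))) ∈ B ↔ (y = p1 ∨ y = n1 ∨ y = m1 ∨ y = q1)) ∧
      (∀ y, ({r1, y} : Finset (EuclideanSpace ℝ (Fin 3))) ∈ B ↔ (y = u1 ∨ y = a1 ∨ y = b1 ∨ y = w1)) ∧
      (({p1, u1} : Finset (EuclideanSpace ℝ (Fin 3))) ∈ B ∧
        ({u1, r1} : Finset (EuclideanSpace ℝ (Fin 3))) ∈ B ∧
        ({r1, b1} : Finset (EuclideanSpace ℝ (Fin 3))) ∈ B ∧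
        ({q1, w1} : Finset (EuclideanSpace ℝ (Fin 3))) ∈ B ∧
        ({w1, r1} : Finset (EuclideanSpace ℝ (Fin 3))) ∈ B ∧
        ({p1, n1} : Finset (EuclideanSpace ℝ (Fin 3))) ∈ B ∧
        ({n1, m1} : Finset (EuclideanSpace ℝ (Fin 3))) ∈ B ∧
        ({m1, q1} : Finset (EuclideanSpace ℝ (Fin 3))) ∈ B) ∧
      (({p1, r1} : Finset (EuclideanSpace ℝ (Fin 3))) ∉ B ∧
        ({u1, b1} : Finset (EuclideanSpace ℝ (Fin 3))) ∉ B ∧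
        ({p1, b1} : Finset (EuclideanSpace ℝ (Fin 3))) ∉ B ∧
        ({q1, r1} : Finset (EuclideanSpace ℝ (Fin 3))) ∉ B ∧
        ({w1, a1} : Finset (EuclideanSpace ℝ (Fin 3))) ∉ B ∧
        ({q1, a1} : Finset (EuclideanSpace ℝ (Fin 3))) ∉ B ∧
        ({p1, m1} : Finset (EuclideanSpace ℝ (Fin 3))) ∉ B ∧
        ({n1, q1} : Finset (EuclideanSpace ℝ (Fin 3))) ∉ B ∧
        ({p1, q1} : Finset (EuclideanSpace ℝ (Fin 3))) ∉ B ∧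
        ({u1, w1} : Finset (EuclideanSpace ℝ (Fin 3))) ∉ B) ∧
      ((p1 ≠ u1 ∧ p1 ≠ r1 ∧ p1 ≠ b1 ∧ u1 ≠ r1 ∧ u1 ≠ b1 ∧ r1 ≠ b1) ∧
        (q1 ≠ w1 ∧ q1 ≠ r1 ∧ q1 ≠ a1 ∧ w1 ≠ r1 ∧ w1 ≠ a1 ∧ r1 ≠ a1) ∧
        (p1 ≠ n1 ∧ p1 ≠ m1 ∧ p1 ≠ q1 ∧ n1 ≠ m1 ∧ n1 ≠ q1 ∧ m1 ≠ q1) ∧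
        (u1 ≠ a1 ∧ u1 ≠ b1 ∧ u1 ≠ w1 ∧ a1 ≠ b1 ∧ a1 ≠ w1 ∧ b1 ≠ w1) ∧ r1 ≠ c1) ∧
      (∀ y, ({p1, y} : Finset (EuclideanSpace ℝ (Fin 3))) ∈ B ↔ (y = a1 ∨ y = u1 ∨ y = c1 ∨ y = n1)) ∧
      (∀ y, ({q1, y} : Finset (EuclideanSpace ℝ (Fin 3))) ∈ B ↔ (y = b1 ∨ y = w1 ∨ y = c1 ∨ y = m1))))
    (h2 : ((p2 ∈ X ∧ q2 ∈ X ∧ u2 ∈ X ∧ w2 ∈ X ∧ m2 ∈ X ∧ n2 ∈ X ∧ r2 ∈ X) ∧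
      (∀ y, ({a2, y} : Finset (EuclideanSpace ℝ (Fin 3))) ∈ B ↔ (y = p2 ∨ y = u2 ∨ y = r2 ∨ y = b2)) ∧
      (∀ y, ({b2, y} : Finset (EuclideanSpace ℝ (Fin 3))) ∈ B ↔ (y = q2 ∨ y = w2 ∨ y = r2 ∨ y = a2)) ∧
      (∀ y, ({c2, y} : Finset (EuclideanSpace ℝ (Fin 3))) ∈ B ↔ (y = p2 ∨ y = n2 ∨ y = m2 ∨ y = q2)) ∧
      (∀ y, ({r2, y} : Finset (EuclideanSpace ℝ (Fin 3))) ∈ B ↔ (y = u2 ∨ y = a2 ∨ y = b2 ∨ y = w2)) ∧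
      (({p2, u2} : Finset (EuclideanSpace ℝ (Fin 3))) ∈ B ∧
        ({u2, r2} : Finset (EuclideanSpace ℝ (Fin 3))) ∈ B ∧
        ({r2, b2} : Finset (EuclideanSpace ℝ (Fin 3))) ∈ B ∧
        ({q2, w2} : Finset (EuclideanSpace ℝ (Fin 3))) ∈ B ∧
        ({w2, r2} : Finset (EuclideanSpace ℝ (Fin 3))) ∈ B ∧
        ({p2, n2} : Finset (EuclideanSpace ℝ (Fin 3))) ∈ B ∧
        ({n2, m2} : Finset (EuclideanSpace ℝ (Fin 3))) ∈ B ∧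
        ({m2, q2} : Finset (EuclideanSpace ℝ (Fin 3))) ∈ B) ∧
      (({p2, r2} : Finset (EuclideanSpace ℝ (Fin 3))) ∉ B ∧
        ({u2, b2} : Finset (EuclideanSpace ℝ (Fin 3))) ∉ B ∧
        ({p2, b2} : Finset (EuclideanSpace ℝ (Fin 3))) ∉ B ∧
        ({q2, r2} : Finset (EuclideanSpace ℝ (Fin 3))) ∉ B ∧
        ({w2, a2} : Finset (EuclideanSpace ℝ (Fin 3))) ∉ B ∧
        ({q2, a2} : Finset (EuclideanSpace ℝ (Fin 3))) ∉ B ∧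
        ({p2, m2} : Finset (EuclideanSpace ℝ (Fin 3))) ∉ B ∧
        ({n2, q2} : Finset (EuclideanSpace ℝ (Fin 3))) ∉ B ∧
        ({p2, q2} : Finset (EuclideanSpace ℝ (Fin 3))) ∉ B ∧
        ({u2, w2} : Finset (EuclideanSpace ℝ (Fin 3))) ∉ B) ∧
      ((p2 ≠ u2 ∧ p2 ≠ r2 ∧ p2 ≠ b2 ∧ u2 ≠ r2 ∧ u2 ≠ b2 ∧ r2 ≠ b2) ∧
        (q2 ≠ w2 ∧ q2 ≠ r2 ∧ q2 ≠ a2 ∧ w2 ≠ r2 ∧ w2 ≠ a2 ∧ r2 ≠ a2) ∧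
        (p2 ≠ n2 ∧ p2 ≠ m2 ∧ p2 ≠ q2 ∧ n2 ≠ m2 ∧ n2 ≠ q2 ∧ m2 ≠ q2) ∧
        (u2 ≠ a2 ∧ u2 ≠ b2 ∧ u2 ≠ w2 ∧ a2 ≠ b2 ∧ a2 ≠ w2 ∧ b2 ≠ w2) ∧ r2 ≠ c2) ∧
      (∀ y, ({p2, y} : Finset (EuclideanSpace ℝ (Fin 3))) ∈ B ↔ (y = a2 ∨ y = u2 ∨ y = c2 ∨ y = n2)) ∧
      (∀ y, ({q2, y} : Finset (EuclideanSpace ℝ (Fin 3))) ∈ B ↔ (y = b2 ∨ y = w2 ∨ y = c2 ∨ y = m2))))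
    {V3 : EuclideanSpace ℝ (Fin 3) → Prop} (hVa1 : V3 a1) (hVb1 : V3 b1) (hVc1 : V3 c1)
    (hVa2 : V3 a2) (hVb2 : V3 b2) (hVc2 : V3 c2) (hVp1 : ¬ V3 p1) (hVq1 : ¬ V3 q1)
    (hVq2 : ¬ V3 q2)
    (hdisj : ∀ y, (y = a1 ∨ y = b1 ∨ y = c1) → ¬ (y = a2 ∨ y = b2 ∨ y = c2))
    (hac1 : a1 ≠ c1) (hbc1 : b1 ≠ c1) (hac2 : a2 ≠ c2) (hbc2 : b2 ≠ c2)
    (hr1 : r1 = a2) : False := by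
  have h1' := h1
  obtain ⟨⟨hp1X, hq1X, hu1X, hw1X, hm1X, hn1X, hr1X⟩, hNa1, hNb1, hNc1, hNr1,
    ⟨hBpu1, hBur1, hBrb1, hBqw1, hBwr1, hBpn1, hBnm1, hBmq1⟩,
    ⟨hBpr1, hBub1, hBpb1, hBqr1, hBwa1, hBqa1, hBpm1, hBnq1, hBpq1, hBuw1⟩,
    ⟨⟨hpu1, hpr1, hpb1, hur1, hub1, hrb1⟩, ⟨hqw1, hqr1, hqa1, hwr1, hwa1, hra1⟩,
      ⟨hpn1, hpm1, hpq1, hnm1, hnq1, hmq1⟩, ⟨hua1, hub'1, huw1, hab1, haw1, hbw1⟩, hrc1⟩,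
    hNp1, hNq1⟩ := h1'
  have h2' := h2
  obtain ⟨-, hNa2, hNb2, -, -, ⟨hBpu2, hBur2, hBrb2, -⟩, ⟨hBpr2, hBub2, hBpb2, -⟩, -⟩ := h2'
  have hNr1' : ∀ y, ({a2, y} : Finset (EuclideanSpace ℝ (Fin 3))) ∈ B ↔
      (y = u1 ∨ y = a1 ∨ y = b1 ∨ y = w1) := hr1 ▸ hNr1
  rcases fan_paths_eq hB hNa2 hNr1' hBpu2 hBur2 hBrb2 hBpr2 hBub2 hBpb2
      (by rw [Finset.pair_comm]; exact (hNa1 u1).2 (Or.inr (Or.inl rfl)))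
      ((hNa1 b1).2 (Or.inr (Or.inr (Or.inr rfl)))) ((hNb1 w1).2 (Or.inr (Or.inl rfl))) hub1 haw1
      hab1 with ⟨-, -, e, -⟩ | ⟨-, e, -, -⟩
  · exact two_blocks_aa hB hcard hdeg hb1 ha1 hc1 ha2 hb2 hc2 (block_swap h1) h2 hVb1 hVc1 hVa2 hVb2
      hVc2 hVq1 hVp1 hVq2 (fun y hy => hdisj y (by rcases hy with h | h | h; exacts [Or.inr (Or.inl h), Or.inl h, Or.inr (Or.inr h)])) hbc1 hac1 hac2 hbc2 hr1 e.symm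
  · exact two_blocks_aa hB hcard hdeg ha1 hb1 hc1 ha2 hb2 hc2 h1 h2 hVa1 hVc1 hVa2 hVb2 hVc2 hVp1
      hVq1 hVq2 hdisj hac1 hbc1 hac2 hbc2 hr1 e.symm

end Setting

end Summit.AtomisticToContinuum.Crystallization.Theorems
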